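import Summits.QuantumFields.GaugeBoot.DiagonalRPTorusTwoZigzagAction
import HarnessLib

/-!
# Diagonal RP on the two-dimensional torus off the back layer, II: the half-turn versus the
crossing weight, and the zigzag average (gauge-boot, task L3(η))

HONEST FRAMING (cell `pub-gaugeboot`, page 1 of every file): the venture produces certified bounds
on lattice expectations at stated coupling, gauge group, dimension and torus size; NOT a mass gap,
NOT a continuum limit, NOT a string tension; NOT Yang–Mills-summit-bearing (barriers
`FixedCouplingUltralocality`, `PerturbativeInvisibility`). This module is part of a small POSITIVE
structural result about which positivity constraints a two-dimensional TORUS certificate may use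
(no two-dimensional certificate with a diagonal block exists or is planned); it discharges nothing
else.

Continuation of `DiagonalRPTorusTwoZigzagAction.lean` (notation there):

* `configDiagSwap_configTau` (`Θ T̂ = T̂ Θ`), `crossE_configTau` (the crossing weight `E` is
  invariant under the half-turn `T̂`: the back-layer plaquettes are permuted by `τ`, the mirror
  ones untouched), `crossE_le` (a bound);
* `measurePreserving_zig` — the fibrewise action preserves product Haar measure (a block two-sided
  translation of the zigzag links by constants, `measurePreserving_blockMul`); `siteMeasure` —
  product Haar probability measure on site functions `k : (ℤ/L)² → G`, invariant under right
  multiplication by a fixed site function and under relabelling by `τ`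
  (`measurePreserving_mul_site`, `measurePreserving_comp_tauSite`); joint measurability of the
  layer-`(c-1)` action (`measurable_zig_onA`);
* `zavg i j g U = ∫ g (zig (onA k) U) dk` — the average over the layer-`(c-1)` action, with the
  Fubini identity `∫ (zavg g) Φ dU = ∫ g Φ dU` for bounded measurable `Φ` invariant under that
  action (`integral_zavg_mul`), and the two facts that drive `DiagonalRPTorusInnerHalf.lean`:
  `zavg (g ∘ T̂) = (zavg g) ∘ T̂` (`zavg_comp_configTau`) and `(zavg g) ∘ T̂ = zavg g` for a
  function `g` of the closed half invariant under the back-layer action (`zavg_configTau`) — a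
  function of the zigzag links invariant under the vertex actions at both layers is invariant
  under the rotation of the cycle, which IS such an action (`configTau_apply_eq_zig`).

All statements are elementary and proved (Fubini over product Haar measure; E. Seiler, LNP 159
(1982) Ch. 2 for the change of variables).
-/

open MeasureTheory Complex Finset Function
open scoped ComplexOrder ENNReal

namespace Summit.QuantumFields.GaugeBoot

open Literature.MathematicalPhysics.QuantumFieldTheory

noncomputable section

namespace DiagRPTwo

/-! ## The crossing weight and the swap versus the half-turn -/

section TauLemmas

variable {L N : ℕ} [NeZero L] {i j : Fin 2} {G : Type*} [Group G] [TopologicalSpace G]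
  [IsTopologicalGroup G] [CompactSpace G] (ρ : G →* Matrix (Fin N) (Fin N) ℂ)

omit [NeZero L] [Group G] [TopologicalSpace G] [IsTopologicalGroup G] [CompactSpace G] in
/-- `Θ T̂ = T̂ Θ` (even `L`). -/
theorem configDiagSwap_configTau (hL : Even L) (U : GaugeConfig 2 L G) :
    configDiagSwap i j (configTau i j U) = configTau i j (configDiagSwap i j U) := by
  funext e
  simp only [configDiagSwap, configTau, edgeTau]
  by_cases ht : TW i j e
  · rw [if_pos ((tw_edgeDiagSwap_iff hL e).2 ht), if_pos ht, edgeDiagSwap_tauEdge]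
  · rw [if_neg fun h => ht ((tw_edgeDiagSwap_iff hL e).1 h), if_neg ht]

omit [NeZero L] [Group G] [TopologicalSpace G] [IsTopologicalGroup G] [CompactSpace G] in
/-- `T̂ Θ T̂ = Θ` (even `L`). -/
theorem configTau_configDiagSwap_configTau (hL : Even L) (U : GaugeConfig 2 L G) :
    configTau i j (configDiagSwap i j (configTau i j U)) = configDiagSwap i j U := by
  rw [configDiagSwap_configTau hL, configTau_configTau hL]

omit [TopologicalSpace G] [IsTopologicalGroup G] [CompactSpace G] in
/-- A mirror plaquette term does not see the half-turn (`L ≥ 4`). -/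
theorem rr_configTau_of_kd_eq_zero (h4 : 4 ≤ L) (hij : i ≠ j) (U : GaugeConfig 2 L G)
    {y : Site 2 L} (hy : kd i j y = 0) : rr ρ i j (configTau i j U) y = rr ρ i j U y :=
  dependsOn_blk i j y (fun c d => ((ρ (c * d⁻¹)).trace).re) fun _ he =>
    configTau_apply_of_not_tw U (not_tw_of_mem_blk_of_kd_eq_zero h4 hij hy he)

omit [NeZero L] [TopologicalSpace G] [IsTopologicalGroup G] [CompactSpace G] in
/-- A back-layer plaquette term is carried by the half-turn to the translated one. -/
theorem rr_configTau_of_kd_eq_cc (hij : i ≠ j) (U : GaugeConfig 2 L G) {y : Site 2 L}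
    (hy : kd i j y = cc L) : rr ρ i j (configTau i j U) y = rr ρ i j U (tauSite y) := by
  have h1 : TW i j (y, i) := Or.inl hy
  have h2 : TW i j (y.shift i, j) := Or.inr (by
    show kd i j ((y.shift i).shift j) = cc L
    rw [kd_shift_right hij, kd_shift_left hij, hy, add_sub_cancel_right])
  have h3 : TW i j (y, j) := Or.inl hy
  have h4 : TW i j (y.shift j, i) := Or.inr (by
    show kd i j ((y.shift j).shift i) = cc L
    rw [kd_shift_left hij, kd_shift_right hij, hy, sub_add_cancel])
  simp only [rr, cT, dT, configTau_apply_of_tw U h1, configTau_apply_of_tw U h2,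
    configTau_apply_of_tw U h3, configTau_apply_of_tw U h4, tauEdge, tauSite_shift]

omit [TopologicalSpace G] [IsTopologicalGroup G] [CompactSpace G] in
/-- **The crossing weight is invariant under the half-turn** (`L ≥ 4` even). -/
theorem crossE_configTau (hL : Even L) (h4 : 4 ≤ L) (hij : i ≠ j) (β : ℝ) (U : GaugeConfig 2 L G) :
    crossE ρ i j β (configTau i j U) = crossE ρ i j β U := by
  have h0 : ∑ y ∈ S0 i j, rr ρ i j (configTau i j U) y = ∑ y ∈ S0 i j, rr ρ i j U y :=
    Finset.sum_congr rfl fun y hy =>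
      rr_configTau_of_kd_eq_zero ρ h4 hij U ((kd_eq_zero_iff y).2 (mem_S0.1 hy))
  have hc : ∑ y ∈ Sc i j, rr ρ i j (configTau i j U) y = ∑ y ∈ Sc i j, rr ρ i j U y := by
    have h1 : ∑ y ∈ Sc i j, rr ρ i j (configTau i j U) y = ∑ y ∈ Sc i j, rr ρ i j U (tauSite y) :=
      Finset.sum_congr rfl fun y hy =>
        rr_configTau_of_kd_eq_cc ρ hij U ((kd_eq_cc_iff h4 y).2 (mem_Sc.1 hy))
    rw [h1]
    exact Finset.sum_nbij' tauSite tauSite (fun y hy => by rwa [mem_Sc, kd_tauSite, ← mem_Sc])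
      (fun y hy => by rwa [mem_Sc, kd_tauSite, ← mem_Sc]) (fun y _ => tauSite_tauSite hL y)
      (fun y _ => tauSite_tauSite hL y) fun y _ => rfl
  rw [crossE, crossE, h0, hc]

/-- `E ≤ exp(|β| (|S0| + |Sc|) N)`: a bound on the crossing weight. -/
theorem crossE_le (hρ : Continuous ρ) (β : ℝ) (U : GaugeConfig 2 L G) :
    crossE ρ i j β U ≤ Real.exp (|β| * (((S0 (L := L) i j).card + (Sc (L := L) i j).card) * N)) := by
  unfold crossE
  refine Real.exp_le_exp.2 ?_
  calc β * (∑ y ∈ S0 i j, rr ρ i j U y + ∑ y ∈ Sc i j, rr ρ i j U y)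
      ≤ |β * (∑ y ∈ S0 i j, rr ρ i j U y + ∑ y ∈ Sc i j, rr ρ i j U y)| := le_abs_self _
    _ = |β| * |∑ y ∈ S0 i j, rr ρ i j U y + ∑ y ∈ Sc i j, rr ρ i j U y| := abs_mul _ _
    _ ≤ |β| * (((S0 (L := L) i j).card + (Sc (L := L) i j).card) * N) := by
        refine mul_le_mul_of_nonneg_left ?_ (abs_nonneg β)
        calc |∑ y ∈ S0 i j, rr ρ i j U y + ∑ y ∈ Sc i j, rr ρ i j U y|
            ≤ |∑ y ∈ S0 i j, rr ρ i j U y| + |∑ y ∈ Sc i j, rr ρ i j U y| := abs_add_le _ _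
          _ ≤ (S0 (L := L) i j).card * N + (Sc (L := L) i j).card * N :=
              add_le_add (abs_sum_rr_le ρ hρ i j _ U) (abs_sum_rr_le ρ hρ i j _ U)
          _ = ((S0 (L := L) i j).card + (Sc (L := L) i j).card) * N := by ring

end TauLemmas

/-! ## Measure preservation and the averaging measure -/

section Measure

variable {L : ℕ} [NeZero L] {i j : Fin 2} {G : Type*} [Group G] [TopologicalSpace G]
  [IsTopologicalGroup G] [CompactSpace G] [MeasurableSpace G] [BorelSpace G]
  [SecondCountableTopology G]

/-- **The fibrewise action preserves product Haar measure** (a block two-sided translation of the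
zigzag links by constants). -/
theorem measurePreserving_zig (h : Site 2 L → G) :
    MeasurePreserving (zig (G := G) i j h) (linkMeasure L G) (linkMeasure L G) := by
  classical
  have hm := measurePreserving_blockMul (G := G) (Finset.univ.filter (ZL (L := L) i j))
    (fun e _ => h e.1) (fun e _ => (h (e.1.shift e.2))⁻¹) (fun _ => measurable_const)
    (fun _ => measurable_const) (fun _ => by intro U V _; rfl) (fun _ => by intro U V _; rfl)
  convert hm using 2 with U
  funext e
  by_cases he : ZL i j e
  · rw [zig_apply_of_zl _ _ he, if_pos (Finset.mem_filter.2 ⟨Finset.mem_univ _, he⟩)]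
  · rw [zig_apply_of_not_zl _ _ he, if_neg fun hm => he (Finset.mem_filter.1 hm).2]

/-- The averaging measure: product Haar probability measure on site functions `k : (ℤ/L)² → G`. -/
abbrev siteMeasure (L : ℕ) [NeZero L] (G : Type*) [Group G] [TopologicalSpace G]
    [IsTopologicalGroup G] [CompactSpace G] [MeasurableSpace G] [BorelSpace G] :
    Measure (Site 2 L → G) :=
  Measure.pi fun _ : Site 2 L => haarProbability G

omit [SecondCountableTopology G] in
/-- Right multiplication by a fixed site function preserves the averaging measure. -/
theorem measurePreserving_mul_site (h : Site 2 L → G) :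
    MeasurePreserving (fun k : Site 2 L → G => k * h) (siteMeasure L G) (siteMeasure L G) := by
  have hm := measurePreserving_pi (fun _ : Site 2 L => haarProbability G)
    (fun _ : Site 2 L => haarProbability G) fun y => WilsonGauge.measurePreserving_mul_mul (1 : G) (h y)
  have he : (fun (k : Site 2 L → G) (y : Site 2 L) => (1 : G) * k y * h y) = fun k => k * h := by
    funext k y
    rw [one_mul, Pi.mul_apply]
  rw [he] at hm
  exact hm

omit [NeZero L] [Group G] [TopologicalSpace G] [IsTopologicalGroup G] [CompactSpace G]
  [BorelSpace G] [SecondCountableTopology G] in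
/-- Relabelling the sites by an involution is the measurable equivalence `piCongrLeft`. -/
theorem coe_piCongrLeft_site {σ : Site 2 L → Site 2 L} (hσ : Function.Involutive σ) :
    ⇑(MeasurableEquiv.piCongrLeft (fun _ : Site 2 L => G) (hσ.toPerm σ)) =
      fun (k : Site 2 L → G) y => k (σ y) := by
  funext k y
  rw [MeasurableEquiv.coe_piCongrLeft]
  have h1 := Equiv.piCongrLeft_apply_apply (P := fun _ : Site 2 L => G) (e := hσ.toPerm σ)
    k ((hσ.toPerm σ).symm y)
  rw [Equiv.apply_symm_apply] at h1
  rw [h1]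
  rfl

omit [SecondCountableTopology G] in
/-- Relabelling the sites by `τ` preserves the averaging measure (even `L`). -/
theorem measurePreserving_comp_tauSite (hL : Even L) :
    MeasurePreserving (fun k : Site 2 L → G => k ∘ tauSite) (siteMeasure L G) (siteMeasure L G) := by
  have hσ : Function.Involutive (tauSite (L := L)) := tauSite_tauSite hL
  have h := MeasureTheory.measurePreserving_piCongrLeft (fun _ : Site 2 L => haarProbability G)
    (hσ.toPerm _)
  rw [coe_piCongrLeft_site hσ] at h
  exact h

omit [NeZero L] [TopologicalSpace G] [IsTopologicalGroup G] [CompactSpace G] [BorelSpace G]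
  [SecondCountableTopology G] in
/-- `k ↦ onA k y` is measurable. -/
theorem measurable_onA_apply (y : Site 2 L) : Measurable fun k : Site 2 L → G => onA i j k y := by
  by_cases hy : kd i j y = cc L - 1
  · have h1 : (fun k : Site 2 L → G => onA i j k y) = fun k => k y := funext fun k => onA_of_eq k hy
    rw [h1]
    exact measurable_pi_apply (X := fun _ : Site 2 L => G) y
  · have h1 : (fun k : Site 2 L → G => onA i j k y) = fun _ => 1 := funext fun k => onA_of_ne k hy
    rw [h1]
    exact measurable_const

omit [NeZero L] [TopologicalSpace G] [IsTopologicalGroup G] [CompactSpace G] [BorelSpace G]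
  [SecondCountableTopology G] in
/-- The layer-`(c-1)` action is jointly measurable in the site function and the configuration. -/
theorem measurable_zig_onA [MeasurableMul₂ G] [MeasurableInv G] :
    Measurable fun p : (Site 2 L → G) × GaugeConfig 2 L G => zig i j (onA i j p.1) p.2 := by
  refine measurable_pi_lambda _ fun e => ?_
  by_cases he : ZL i j e
  · have h1 : (fun p : (Site 2 L → G) × GaugeConfig 2 L G => zig i j (onA i j p.1) p.2 e) =
        fun p => onA i j p.1 e.1 * p.2 e * (onA i j p.1 (e.1.shift e.2))⁻¹ :=
      funext fun p => zig_apply_of_zl _ _ he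
    rw [h1]
    have hU : Measurable fun p : (Site 2 L → G) × GaugeConfig 2 L G => p.2 e :=
      (measurable_pi_apply (X := fun _ : Edge 2 L => G) e).comp measurable_snd
    exact (((measurable_onA_apply _).comp measurable_fst).mul hU).mul
      ((measurable_onA_apply _).comp measurable_fst).inv
  · have h1 : (fun p : (Site 2 L → G) × GaugeConfig 2 L G => zig i j (onA i j p.1) p.2 e) =
        fun p => p.2 e := funext fun p => zig_apply_of_not_zl _ _ he
    rw [h1]
    exact (measurable_pi_apply (X := fun _ : Edge 2 L => G) e).comp measurable_snd

omit [NeZero L] [TopologicalSpace G] [IsTopologicalGroup G] [CompactSpace G] [BorelSpace G]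
  [SecondCountableTopology G] in
/-- The layer-`(c-1)` action is measurable in the site function. -/
theorem measurable_zig_onA_left [MeasurableMul₂ G] [MeasurableInv G] (U : GaugeConfig 2 L G) :
    Measurable fun k : Site 2 L → G => zig i j (onA i j k) U :=
  measurable_zig_onA.comp (measurable_id.prodMk measurable_const)

end Measure

/-! ## The zigzag average -/

section Average

variable {L : ℕ} [NeZero L] {i j : Fin 2} {G : Type*} [Group G] [TopologicalSpace G]
  [IsTopologicalGroup G] [CompactSpace G] [MeasurableSpace G] [BorelSpace G]
  [SecondCountableTopology G]

variable (i j) in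
/-- The average of `g` over the layer-`(c-1)` action: `(zavg g)(U) = ∫ g(zig (onA k) U) dk`. -/
def zavg (g : GaugeConfig 2 L G → ℂ) (U : GaugeConfig 2 L G) : ℂ :=
  ∫ k, g (zig i j (onA i j k) U) ∂(siteMeasure L G)

omit [SecondCountableTopology G] in
/-- The average is bounded by the bound of `g`. -/
theorem norm_zavg_le {g : GaugeConfig 2 L G → ℂ} {C : ℝ} (hgb : ∀ U, ‖g U‖ ≤ C)
    (U : GaugeConfig 2 L G) : ‖zavg i j g U‖ ≤ C := by
  have h := norm_integral_le_of_norm_le_const (μ := siteMeasure L G)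
    (f := fun k : Site 2 L → G => g (zig i j (onA i j k) U)) (Filter.Eventually.of_forall fun k => hgb _)
  rwa [probReal_univ, mul_one] at h

/-- The average is measurable. -/
theorem measurable_zavg {g : GaugeConfig 2 L G → ℂ} (hg : Measurable g) : Measurable (zavg i j g) := by
  have hsm : StronglyMeasurable fun p : (Site 2 L → G) × GaugeConfig 2 L G =>
      g (zig i j (onA i j p.1) p.2) := (hg.comp measurable_zig_onA).stronglyMeasurable
  exact (MeasureTheory.StronglyMeasurable.integral_prod_left' (μ := siteMeasure L G) hsm).measurable

omit [SecondCountableTopology G] in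
/-- The average of a function of the closed half is a function of the closed half. -/
theorem dependsOn_zavg {g : GaugeConfig 2 L G → ℂ}
    (hg : DependsOn g (halfLinks (L := L) i j : Set (Edge 2 L))) :
    DependsOn (zavg i j g) (halfLinks (L := L) i j : Set (Edge 2 L)) := by
  intro U V hUV
  unfold zavg
  exact integral_congr_ae (Filter.Eventually.of_forall fun k => dependsOn_comp_zig hg _ hUV)

/-- **Fubini identity of the average**: `∫ (zavg g) Φ dU = ∫ g Φ dU` for every bounded measurable
`Φ` invariant under the layer-`(c-1)` action. -/
theorem integral_zavg_mul {g Φ : GaugeConfig 2 L G → ℂ} (hg : Measurable g) {Cg : ℝ}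
    (hgb : ∀ U, ‖g U‖ ≤ Cg) (hΦ : Measurable Φ) {CΦ : ℝ} (hΦb : ∀ U, ‖Φ U‖ ≤ CΦ)
    (hΦz : ∀ k U, Φ (zig i j (onA i j k) U) = Φ U) :
    ∫ U, zavg i j g U * Φ U ∂(linkMeasure L G) = ∫ U, g U * Φ U ∂(linkMeasure L G) := by
  have h1 : ∀ U, zavg i j g U * Φ U =
      ∫ k, g (zig i j (onA i j k) U) * Φ U ∂(siteMeasure L G) := fun U =>
    (integral_mul_const (Φ U) _).symm
  simp_rw [h1]
  have hint : Integrable (Function.uncurry fun (U : GaugeConfig 2 L G) (k : Site 2 L → G) =>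
      g (zig i j (onA i j k) U) * Φ U) ((linkMeasure L G).prod (siteMeasure L G)) := by
    have hm : Measurable (Function.uncurry fun (U : GaugeConfig 2 L G) (k : Site 2 L → G) =>
        g (zig i j (onA i j k) U) * Φ U) :=
      (hg.comp (measurable_zig_onA.comp (measurable_snd.prodMk measurable_fst))).mul
        (hΦ.comp measurable_fst)
    refine Integrable.of_bound hm.aestronglyMeasurable (Cg * CΦ) (Filter.Eventually.of_forall ?_)
    rintro ⟨U, k⟩
    simp only [Function.uncurry_apply_pair, norm_mul]
    exact mul_le_mul (hgb _) (hΦb _) (norm_nonneg _) ((norm_nonneg _).trans (hgb U))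
  rw [integral_integral_swap hint]
  have h2 : ∀ k : Site 2 L → G, ∫ U, g (zig i j (onA i j k) U) * Φ U ∂(linkMeasure L G) =
      ∫ U, g U * Φ U ∂(linkMeasure L G) := fun k => by
    have h := LatticeRP.integral_comp_eq_of_measurePreserving
      (measurePreserving_zig (i := i) (j := j) (onA i j k))
      (Φ := fun U => g U * Φ U) (hg.mul hΦ)
    simp only [hΦz] at h
    exact h
  simp_rw [h2]
  rw [integral_const, probReal_univ, one_smul]

/-- The average is invariant under the layer-`(c-1)` action (right invariance of Haar measure). -/
theorem zavg_zig_onA {g : GaugeConfig 2 L G → ℂ} (hg : Measurable g) (h : Site 2 L → G)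
    (U : GaugeConfig 2 L G) : zavg i j g (zig i j (onA i j h) U) = zavg i j g U := by
  unfold zavg
  have h1 : ∀ k, g (zig i j (onA i j k) (zig i j (onA i j h) U)) = g (zig i j (onA i j (k * h)) U) :=
    fun k => by rw [onA_mul, zig_mul]
  simp_rw [h1]
  exact LatticeRP.integral_comp_eq_of_measurePreserving (measurePreserving_mul_site h)
    (Φ := fun k => g (zig i j (onA i j k) U)) (hg.comp (measurable_zig_onA_left U))

omit [SecondCountableTopology G] in
/-- The average inherits invariance under the back-layer action (`L ≥ 4`). -/
theorem zavg_zig_onB (h4 : 4 ≤ L) {g : GaugeConfig 2 L G → ℂ}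
    (hgB : ∀ k U, g (zig i j (onB i j k) U) = g U) (k' : Site 2 L → G) (U : GaugeConfig 2 L G) :
    zavg i j g (zig i j (onB i j k') U) = zavg i j g U := by
  unfold zavg
  exact integral_congr_ae (Filter.Eventually.of_forall fun k => by
    simp only [zig_onA_onB_comm h4, hgB])

/-- **The average does not see the half-turn** (`L ≥ 4`): `(zavg g)(T̂ U) = (zavg g)(U)` for a
function `g` of the closed half invariant under the back-layer action — a function of the zigzag
links invariant under the vertex actions at both layers is invariant under the rotation of the
cycle, which is such an action (`configTau_apply_eq_zig`). -/
theorem zavg_configTau (h4 : 4 ≤ L) (hij : i ≠ j) {g : GaugeConfig 2 L G → ℂ} (hg : Measurable g)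
    (hgH : DependsOn g (halfLinks (L := L) i j : Set (Edge 2 L)))
    (hgB : ∀ k U, g (zig i j (onB i j k) U) = g U) (U : GaugeConfig 2 L G) :
    zavg i j g (configTau i j U) = zavg i j g U := by
  have h1 : zavg i j g (configTau i j U) = zavg i j g (zig i j (hfun i j U) U) :=
    dependsOn_zavg hgH fun e he =>
      configTau_apply_eq_zig h4 hij U (mem_halfLinks.1 (Finset.mem_coe.1 he))
  rw [h1, zig_eq_zig_onA_onB h4 hij, zavg_zig_onA hg, zavg_zig_onB h4 hgB]

/-- **The average commutes with the half-turn** (even `L`): `zavg (g ∘ T̂) = (zavg g) ∘ T̂`. -/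
theorem zavg_comp_configTau (hL : Even L) {g : GaugeConfig 2 L G → ℂ} (hg : Measurable g)
    (U : GaugeConfig 2 L G) :
    zavg i j (fun V => g (configTau i j V)) U = zavg i j g (configTau i j U) := by
  unfold zavg
  have h1 : ∀ k, g (configTau i j (zig i j (onA i j k) U)) =
      g (zig i j (onA i j (k ∘ tauSite)) (configTau i j U)) := fun k => by
    rw [configTau_zig, onA_comp_tauSite]
  simp_rw [h1]
  exact LatticeRP.integral_comp_eq_of_measurePreserving (measurePreserving_comp_tauSite hL)
    (Φ := fun k => g (zig i j (onA i j k) (configTau i j U)))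
    (hg.comp (measurable_zig_onA_left _))

end Average

end DiagRPTwo

end

end Summit.QuantumFields.GaugeBoot
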